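import Summits.MatrixMultiplication.MatrixMultiplication.Theorems.SoloBlindConeLift
import Summits.MatrixMultiplication.MatrixMultiplication.Theorems.SoloBlindMassCalculus

/-!
# The twist: (K₃) is twist-closed, and (K₃) + GE2 one rank down give Conjecture E on every twist

Sub-programme (K₃), notation of `SoloBlindConeLift`: `K(τ; S) = ∑_{T ⊆ S, ∑_T h = τ} 2^{-|T|}`
(`soloBlindMass`), (K₃) = `K ≤ 1`, CONJECTURE E = `K(τ; S) ≤ 1/2` for H-good `τ`, and GE2 = the cross
inequality `K(t₁; S) + K(t₂; S) ≤ 1` whenever NO sub-sum of `S` (the empty one included) equals `t₁ + t₂`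
(E is GE2 at `t₁ = t₂`).

THE TWIST of `h : ι → G` along `a : G` is the map `soloBlindTwist h a` on `Option (Option ι)` with values in
`G × ZMod 3`: the old indices go to `(h i, 0)` (`soloBlindFlat`), the two new points `q = some none` and
`p = none` go to `(a, 1)` and `(0, 1)` — "adjoin `b` and `b + a` for a fresh direction `b`".  The binary lifts
`{a} ∪ {b_i, b_i + a}` of the tight census are iterated twists of a singleton.  Results (all ranks, no
finiteness of `G` needed):
* the twist of a zero-sum-free map is zero-sum free on `insertNone (insertNone S)` (`soloBlind_twist_zsf`);
* EXACT MASS FORMULAS (`soloBlind_twist_mass_zero/one/two`):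
  `K((σ,0); S*) = K(σ; S)`, `K((σ,1); S*) = (K(σ; S) + K(σ - a; S)) / 2`, `K((σ,2); S*) = K(σ - a; S) / 4`
  — every twisted mass is an average of masses one rank down;
* hence (K₃) IS TWIST-CLOSED (`soloBlind_twist_kraft`): `K ≤ 1` on `S` gives `K ≤ 1` on the twist, at every
  target, so every iterated twist of a configuration satisfying (K₃) satisfies (K₃);
* THEOREM A (`soloBlind_twist_conjE`): if `S` satisfies (K₃) and GE2 then the twist satisfies CONJECTURE E at
  EVERY H-good target: a target `(σ,1)` is H-good on the twist only if no sub-sum of `S` equals `σ + (σ - a)`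
  (`soloBlind_twist_pair_free`), and then GE2 at the pair `σ, σ - a` gives `K((σ,1); S*) ≤ 1/2`; targets
  `(σ,0)` reduce to E on `S` (`soloBlind_twist_hgood_zero`) and targets `(σ,2)` have mass `≤ 1/4`.
So the equality `E = 1/2` on a twist forces `K(σ; S) + K(σ - a; S) = 1`: a GE2-tight pair one rank down — the
mechanism behind every binary-lift equality case.
-/

namespace Summit.MatrixMultiplication.MatrixMultiplication.Theorems

open Finset

universe u v

variable {ι : Type v} [DecidableEq ι]
variable {G : Type u} [AddCommGroup G] [DecidableEq G]

omit [DecidableEq ι] in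
/-- Kraft masses are non-negative. -/
theorem soloBlind_mass_nonneg (h : ι → G) (S : Finset ι) (τ : G) : 0 ≤ soloBlindMass h S τ :=
  Finset.sum_nonneg fun T _ => by positivity

/-- The three residues modulo `3`. -/
theorem soloBlind_zmod3_cases (x : ZMod 3) : x = 0 ∨ x = 1 ∨ x = 2 := by
  revert x; decide

/-! ### The flat embedding `i ↦ (h i, 0)` -/

/-- The flat embedding of `h` into the first factor of `G × ZMod 3`. -/
def soloBlindFlat (h : ι → G) : ι → G × ZMod 3 := fun i => (h i, 0)

omit [DecidableEq ι] [DecidableEq G] in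
/-- Sub-sums of the flat embedding. -/
theorem soloBlind_flat_sum (h : ι → G) (T : Finset ι) :
    ∑ i ∈ T, soloBlindFlat h i = ((∑ i ∈ T, h i, 0) : G × ZMod 3) := by
  ext
  · rw [Prod.fst_sum]
    exact Finset.sum_congr rfl fun i _ => rfl
  · rw [Prod.snd_sum]
    exact Finset.sum_eq_zero fun i _ => rfl

omit [DecidableEq ι] in
/-- Representations of `(σ, 0)` under the flat embedding are the representations of `σ`. -/
theorem soloBlind_flat_repAll_zero (h : ι → G) (S : Finset ι) (σ : G) :
    soloBlindSeqRepAll (soloBlindFlat h) S ((σ, 0) : G × ZMod 3) = soloBlindSeqRepAll h S σ := by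
  ext T
  rw [soloBlind_mem_seqRepAll, soloBlind_mem_seqRepAll, soloBlind_flat_sum, Prod.mk.injEq]
  constructor
  · rintro ⟨hT, hs, -⟩
    exact ⟨hT, hs⟩
  · rintro ⟨hT, hs⟩
    exact ⟨hT, hs, rfl⟩

omit [DecidableEq ι] in
/-- No sub-sum of the flat embedding has a non-zero second coordinate. -/
theorem soloBlind_flat_repAll_ne (h : ι → G) (S : Finset ι) (σ : G) {β : ZMod 3} (hβ : β ≠ 0) :
    soloBlindSeqRepAll (soloBlindFlat h) S ((σ, β) : G × ZMod 3) = ∅ := by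
  ext T
  rw [soloBlind_mem_seqRepAll, soloBlind_flat_sum, Prod.mk.injEq]
  constructor
  · rintro ⟨-, -, h0⟩
    exact absurd h0.symm hβ
  · intro hT
    exact absurd hT (Finset.notMem_empty T)

omit [DecidableEq ι] in
/-- Flat masses at `(σ, 0)`. -/
theorem soloBlind_flat_mass_zero (h : ι → G) (S : Finset ι) (σ : G) :
    soloBlindMass (soloBlindFlat h) S ((σ, 0) : G × ZMod 3) = soloBlindMass h S σ := by
  rw [soloBlindMass, soloBlind_flat_repAll_zero, soloBlindMass]

omit [DecidableEq ι] in
/-- Flat masses vanish off the first factor. -/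
theorem soloBlind_flat_mass_ne (h : ι → G) (S : Finset ι) (σ : G) {β : ZMod 3} (hβ : β ≠ 0) :
    soloBlindMass (soloBlindFlat h) S ((σ, β) : G × ZMod 3) = 0 := by
  rw [soloBlindMass, soloBlind_flat_repAll_ne h S σ hβ, Finset.sum_empty]

omit [DecidableEq ι] [DecidableEq G] in
/-- The flat embedding of a zero-sum-free map is zero-sum free. -/
theorem soloBlind_flat_zsf {h : ι → G} {S : Finset ι} (zsf : ∀ T ⊆ S, T.Nonempty → ∑ i ∈ T, h i ≠ 0) :
    ∀ T ⊆ S, T.Nonempty → ∑ i ∈ T, soloBlindFlat h i ≠ 0 := by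
  intro T hT hne hsum
  rw [soloBlind_flat_sum] at hsum
  exact zsf T hT hne (congrArg Prod.fst hsum)

/-! ### The twist `S ∪ {b, b + a}` -/

/-- The twist of `h` along `a`: `some (some i) ↦ (h i, 0)`, `some none ↦ (a, 1)`, `none ↦ (0, 1)`. -/
def soloBlindTwist (h : ι → G) (a : G) : Option (Option ι) → G × ZMod 3 :=
  soloBlindAdjoin (soloBlindAdjoin (soloBlindFlat h) (a, 1)) (0, 1)

/-- Erasing the apex of `insertNone X` leaves the image of `X`. -/
theorem soloBlind_insertNone_erase {κ : Type*} [DecidableEq κ] (X : Finset κ) :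
    (insertNone X).erase none = X.map Function.Embedding.some := by
  ext o
  cases o with
  | none => simp
  | some i => simp

omit [DecidableEq ι] [DecidableEq G] in
/-- `insertNone` is monotone. -/
theorem soloBlind_insertNone_mono {κ : Type*} {T S : Finset κ} (hTS : T ⊆ S) :
    insertNone T ⊆ insertNone S := by
  intro o ho
  rw [mem_insertNone] at ho ⊢
  intro a ha
  exact hTS (ho a ha)

omit [DecidableEq ι] in
/-- One deletion step: the mass after adjoining an apex of value `c` to `f` on `X`, at any target `t`, is
`K(t; X) + K(t - c; X) / 2` (masses of `f`). -/
theorem soloBlind_adjoin_mass_any {κ : Type v} [DecidableEq κ] (f : κ → G × ZMod 3) (X : Finset κ)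
    (c t : G × ZMod 3) :
    soloBlindMass (soloBlindAdjoin f c) (insertNone X) t =
      soloBlindMass f X t + 1 / 2 * soloBlindMass f X (t - c) := by
  rw [soloBlind_mass_erase (soloBlindAdjoin f c) (none_mem_insertNone (s := X)) t,
    soloBlind_insertNone_erase,
    soloBlind_mass_map Function.Embedding.some (soloBlindAdjoin f c) f (fun _ => rfl) X t,
    soloBlind_mass_map Function.Embedding.some (soloBlindAdjoin f c) f (fun _ => rfl) X (t - _)]
  rfl

/-- The deletion chain for the twist: four flat masses. -/
theorem soloBlind_twist_mass_chain (h : ι → G) (S : Finset ι) (a : G) (t : G × ZMod 3) :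
    soloBlindMass (soloBlindTwist h a) (insertNone (insertNone S)) t =
      soloBlindMass (soloBlindFlat h) S t + 1 / 2 * soloBlindMass (soloBlindFlat h) S (t - (a, 1)) +
        1 / 2 * (soloBlindMass (soloBlindFlat h) S (t - (0, 1)) +
          1 / 2 * soloBlindMass (soloBlindFlat h) S (t - (0, 1) - (a, 1))) := by
  rw [soloBlindTwist, soloBlind_adjoin_mass_any, soloBlind_adjoin_mass_any, soloBlind_adjoin_mass_any]

/-- TWIST MASS at `(σ, 0)`: `K((σ,0); S*) = K(σ; S)`. -/
theorem soloBlind_twist_mass_zero (h : ι → G) (S : Finset ι) (a σ : G) :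
    soloBlindMass (soloBlindTwist h a) (insertNone (insertNone S)) ((σ, 0) : G × ZMod 3) =
      soloBlindMass h S σ := by
  have e1 : ((0 : ZMod 3) - 1) = 2 := by decide
  have e2 : ((2 : ZMod 3) - 1) = 1 := by decide
  rw [soloBlind_twist_mass_chain, Prod.mk_sub_mk, Prod.mk_sub_mk, Prod.mk_sub_mk, e1, e2,
    soloBlind_flat_mass_zero, soloBlind_flat_mass_ne h S _ (show (2 : ZMod 3) ≠ 0 by decide),
    soloBlind_flat_mass_ne h S _ (show (2 : ZMod 3) ≠ 0 by decide),
    soloBlind_flat_mass_ne h S _ (show (1 : ZMod 3) ≠ 0 by decide)]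
  ring

/-- TWIST MASS at `(σ, 1)`: `K((σ,1); S*) = (K(σ; S) + K(σ - a; S)) / 2`. -/
theorem soloBlind_twist_mass_one (h : ι → G) (S : Finset ι) (a σ : G) :
    soloBlindMass (soloBlindTwist h a) (insertNone (insertNone S)) ((σ, 1) : G × ZMod 3) =
      1 / 2 * (soloBlindMass h S σ + soloBlindMass h S (σ - a)) := by
  have e1 : ((1 : ZMod 3) - 1) = 0 := by decide
  have e2 : ((0 : ZMod 3) - 1) = 2 := by decide
  rw [soloBlind_twist_mass_chain, Prod.mk_sub_mk, Prod.mk_sub_mk, Prod.mk_sub_mk, e1, e2, sub_zero,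
    soloBlind_flat_mass_ne h S _ (show (1 : ZMod 3) ≠ 0 by decide), soloBlind_flat_mass_zero,
    soloBlind_flat_mass_zero, soloBlind_flat_mass_ne h S _ (show (2 : ZMod 3) ≠ 0 by decide)]
  ring

/-- TWIST MASS at `(σ, 2)`: `K((σ,2); S*) = K(σ - a; S) / 4`. -/
theorem soloBlind_twist_mass_two (h : ι → G) (S : Finset ι) (a σ : G) :
    soloBlindMass (soloBlindTwist h a) (insertNone (insertNone S)) ((σ, 2) : G × ZMod 3) =
      1 / 4 * soloBlindMass h S (σ - a) := by
  have e1 : ((2 : ZMod 3) - 1) = 1 := by decide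
  have e2 : ((1 : ZMod 3) - 1) = 0 := by decide
  rw [soloBlind_twist_mass_chain, Prod.mk_sub_mk, Prod.mk_sub_mk, Prod.mk_sub_mk, e1, e2, sub_zero,
    soloBlind_flat_mass_ne h S _ (show (2 : ZMod 3) ≠ 0 by decide),
    soloBlind_flat_mass_ne h S _ (show (1 : ZMod 3) ≠ 0 by decide),
    soloBlind_flat_mass_ne h S _ (show (1 : ZMod 3) ≠ 0 by decide), soloBlind_flat_mass_zero]
  ring

/-! ### Zero-sum-freeness and H-goodness transfer -/

omit [DecidableEq G] in
/-- Second coordinate of a sub-sum after adjoining `(a, 1)` to the flat embedding: `1` or `0`. -/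
theorem soloBlind_inner_sum_snd (h : ι → G) (a : G) (U : Finset (Option ι)) :
    (∑ o ∈ U, soloBlindAdjoin (soloBlindFlat h) (a, 1) o).2 = if none ∈ U then 1 else 0 := by
  rw [soloBlind_adjoin_sum, Prod.snd_add, soloBlind_flat_sum]
  by_cases hn : none ∈ U
  · rw [if_pos hn, if_pos hn]
    exact add_zero _
  · rw [if_neg hn, if_neg hn]
    exact add_zero _

omit [DecidableEq G] in
/-- The twist of a zero-sum-free map is zero-sum free (for ANY shift `a`). -/
theorem soloBlind_twist_zsf (three : ∀ g : G, g + g + g = 0) {h : ι → G} {S : Finset ι} (a : G)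
    (zsf : ∀ T ⊆ S, T.Nonempty → ∑ i ∈ T, h i ≠ 0) :
    ∀ T ⊆ insertNone (insertNone S), T.Nonempty → ∑ o ∈ T, soloBlindTwist h a o ≠ 0 := by
  classical
  have three' := soloBlind_cone_three (G := G) three
  have hin : ∀ U ⊆ insertNone S, U.Nonempty →
      ∑ o ∈ U, soloBlindAdjoin (soloBlindFlat h) (a, 1) o ≠ 0 := by
    refine soloBlind_adjoin_zsf three' (soloBlind_flat_zsf zsf) ?_
    intro T _ hsum
    have h2 := congrArg Prod.snd hsum
    rw [soloBlind_flat_sum] at h2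
    change (0 : ZMod 3) = 1 + 1 at h2
    exact absurd h2 (by decide)
  refine soloBlind_adjoin_zsf three' hin ?_
  intro U _ hsum
  have h2 := congrArg Prod.snd hsum
  rw [soloBlind_inner_sum_snd] at h2
  change (if none ∈ U then (1 : ZMod 3) else 0) = 1 + 1 at h2
  by_cases hn : none ∈ U
  · rw [if_pos hn] at h2
    exact absurd h2 (by decide)
  · rw [if_neg hn] at h2
    exact absurd h2 (by decide)

omit [DecidableEq G] in
/-- The sum of the twist over the double lift `insertNone (insertNone T)` of `T ⊆ S`. -/
theorem soloBlind_twist_sum_lift (h : ι → G) (a : G) (T : Finset ι) :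
    ∑ o ∈ insertNone (insertNone T), soloBlindTwist h a o = ((a + ∑ i ∈ T, h i, 2) : G × ZMod 3) := by
  rw [soloBlindTwist, soloBlind_adjoin_sum, if_pos none_mem_insertNone, eraseNone_insertNone,
    soloBlind_adjoin_sum, if_pos none_mem_insertNone, eraseNone_insertNone, soloBlind_flat_sum]
  ext
  · change (0 : G) + (a + ∑ i ∈ T, h i) = a + ∑ i ∈ T, h i
    exact zero_add _
  · change (1 : ZMod 3) + (1 + 0) = 2
    decide

omit [DecidableEq ι] [DecidableEq G] in
/-- The sum of the twist over the flat lift of `T ⊆ S`. -/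
theorem soloBlind_twist_sum_flat (h : ι → G) (a : G) (T : Finset ι) :
    ∑ o ∈ (T.map Function.Embedding.some).map Function.Embedding.some, soloBlindTwist h a o =
      ((∑ i ∈ T, h i, 0) : G × ZMod 3) := by
  rw [Finset.sum_map, Finset.sum_map, ← soloBlind_flat_sum]
  rfl

omit [DecidableEq G] in
/-- H-GOODNESS TRANSFER at `(σ, 1)`: if `(σ, 1)` is H-good on the twist then no sub-sum of `S` equals
`σ + (σ - a)` (else `{p, q} ∪ T` sums to `(σ,1) + (σ,1)`). -/
theorem soloBlind_twist_pair_free (h : ι → G) (S : Finset ι) (a σ : G)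
    (hgood : ∀ T ⊆ insertNone (insertNone S),
      ∑ o ∈ T, soloBlindTwist h a o ≠ ((σ, 1) : G × ZMod 3) + (σ, 1)) :
    ∀ T ⊆ S, ∑ i ∈ T, h i ≠ σ + (σ - a) := by
  intro T hT hs
  refine hgood (insertNone (insertNone T)) (soloBlind_insertNone_mono (soloBlind_insertNone_mono hT)) ?_
  rw [soloBlind_twist_sum_lift, hs, Prod.mk_add_mk]
  ext
  · change a + (σ + (σ - a)) = σ + σ
    have : a + (σ + (σ - a)) - (σ + σ) = 0 := by abel
    exact sub_eq_zero.mp this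
  · change (2 : ZMod 3) = 1 + 1
    decide

omit [DecidableEq ι] [DecidableEq G] in
/-- H-GOODNESS TRANSFER at `(σ, 0)`: if `(σ, 0)` is H-good on the twist then `σ` is H-good on `S`. -/
theorem soloBlind_twist_hgood_zero (h : ι → G) (S : Finset ι) (a σ : G)
    (hgood : ∀ T ⊆ insertNone (insertNone S),
      ∑ o ∈ T, soloBlindTwist h a o ≠ ((σ, 0) : G × ZMod 3) + (σ, 0)) :
    ∀ T ⊆ S, ∑ i ∈ T, h i ≠ σ + σ := by
  intro T hT hs
  refine hgood ((T.map Function.Embedding.some).map Function.Embedding.some) ?_ ?_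
  · intro o ho
    rw [Finset.mem_map] at ho
    obtain ⟨o', ho', rfl⟩ := ho
    rw [Finset.mem_map] at ho'
    obtain ⟨i, hi, rfl⟩ := ho'
    exact mem_insertNone.mpr fun o'' ho'' => by
      cases ho''
      exact mem_insertNone.mpr fun i' hi' => by
        cases hi'
        exact hT hi
  · rw [soloBlind_twist_sum_flat, hs, Prod.mk_add_mk, add_zero]

/-! ### (K₃) is twist-closed; (K₃) + GE2 give Conjecture E on the twist -/

/-- (K₃) IS TWIST-CLOSED: if `K(σ; S) ≤ 1` for every `σ` then `K(t; S*) ≤ 1` for every target `t` of the twist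
(any shift `a`). -/
theorem soloBlind_twist_kraft (h : ι → G) (S : Finset ι) (a : G) (hK : ∀ σ : G, soloBlindMass h S σ ≤ 1)
    (t : G × ZMod 3) : soloBlindMass (soloBlindTwist h a) (insertNone (insertNone S)) t ≤ 1 := by
  obtain ⟨σ, β⟩ := t
  rcases soloBlind_zmod3_cases β with rfl | rfl | rfl
  · rw [soloBlind_twist_mass_zero]
    exact hK σ
  · rw [soloBlind_twist_mass_one]
    have := hK σ
    have := hK (σ - a)
    linarith
  · rw [soloBlind_twist_mass_two]
    have := hK (σ - a)
    have := soloBlind_mass_nonneg h S (σ - a)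
    linarith

/-- THEOREM A (one twist step).  If `S` satisfies (K₃) (`K ≤ 1` at every target) and GE2 (`K(t₁) + K(t₂) ≤ 1`
whenever no sub-sum of `S` equals `t₁ + t₂`; at `t₁ = t₂` this is Conjecture E for `S`), then the twist along ANY
`a : G` satisfies CONJECTURE E at EVERY H-good target (no exponent hypothesis is needed for this step). -/
theorem soloBlind_twist_conjE (h : ι → G) (S : Finset ι) (a : G)
    (hK : ∀ σ : G, soloBlindMass h S σ ≤ 1)
    (hGE2 : ∀ t₁ t₂ : G, (∀ T ⊆ S, ∑ i ∈ T, h i ≠ t₁ + t₂) →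
      soloBlindMass h S t₁ + soloBlindMass h S t₂ ≤ 1)
    (t : G × ZMod 3)
    (hgood : ∀ T ⊆ insertNone (insertNone S), ∑ o ∈ T, soloBlindTwist h a o ≠ t + t) :
    soloBlindMass (soloBlindTwist h a) (insertNone (insertNone S)) t ≤ 1 / 2 := by
  obtain ⟨σ, β⟩ := t
  rcases soloBlind_zmod3_cases β with rfl | rfl | rfl
  · rw [soloBlind_twist_mass_zero]
    have := hGE2 σ σ (soloBlind_twist_hgood_zero h S a σ hgood)
    linarith
  · rw [soloBlind_twist_mass_one]
    have := hGE2 σ (σ - a) (soloBlind_twist_pair_free h S a σ hgood)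
    linarith
  · rw [soloBlind_twist_mass_two]
    have := hK (σ - a)
    linarith

/-- EQUALITY MECHANISM: `E = 1/2` at an H-good target `(σ, 1)` of the twist forces the GE2 pair `σ, σ - a` of `S`
to be tight, `K(σ; S) + K(σ - a; S) = 1`. -/
theorem soloBlind_twist_tight_pair (h : ι → G) (S : Finset ι) (a σ : G)
    (htight : soloBlindMass (soloBlindTwist h a) (insertNone (insertNone S)) ((σ, 1) : G × ZMod 3) = 1 / 2) :
    soloBlindMass h S σ + soloBlindMass h S (σ - a) = 1 := by
  rw [soloBlind_twist_mass_one] at htight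
  linarith

end Summit.MatrixMultiplication.MatrixMultiplication.Theorems
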